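import Mathlib
import HarnessLib
import Summits.NavierStokesRegularity.NavierStokesRegularity.Theorems.PoloidalWindowDoorLrcModEntireAxisKinematics
import Summits.NavierStokesRegularity.NavierStokesRegularity.Theorems.PoloidalWindowDoorLrcModEntireAxisKinematics3

/-!
# Route `PoloidalWindowDoor`, item `LrcModEntire` (stmt-NavierStokesRegularity-20428) — AXIS KINEMATICS VI: radial structure about a
# MOVING centre `c(z)` — `V = P(ρ_c², z)` from the rotation germ, and `L`-invariance of every `Q(ρ_c², z)`

Cell ns-regularity-ideate, seat ns-poloidal-K2-p3 gen 5 (LEAD of item 20428; file landed `--supports stmt-NavierStokesRegularity-20428` as a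
helper).  Sixth kernel brick of AXIS-NOTE: the per-plane radial structure with a HEIGHT-DEPENDENT centre `c(z) = (c₀(z), c₁(z))` (the format
in which the planar Levi-Civita–Segre lemma delivers its centres, one per plane), needed to feed `…AxisKinematics3/4` (`(★)` and the
harmonics lemma).  With `g(y) := (y₀ − c₀(y₂))² + (y₁ − c₁(y₂))²` and `L f(y) := (y₀ − c₀(y₂))∂₁f(y) − (y₁ − c₁(y₂))∂₀f(y)`:

* `fderiv_sqDistMoving_horizontal` — `Dg(y) e_b = 2(y_b − c_b(y₂))` for `b = 0, 1` (the centre does not move horizontally);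
* `exists_radial_of_rotGerm_moving` — **`V` of class `Cⁿ` at `y₀`, `L V = 0` near `y₀`, `y₀` off the axis ⇒ `V y = P(g y, y₂)` near `y₀`
  with `P : ℝ × ℝ → ℝ` of class `Cⁿ` at `(g y₀, (y₀)₂)`** (functional dependence, Literature `exists_comp_slice`, bracket `= −2·LV`);
* `rotDeriv_comp_sqDistMoving` — **`L(Q(g, ·₂)) = 0`** pointwise for any `Q : ℝ × ℝ → ℝ` differentiable at `(g y, y₂)`: functions of
  `(ρ_c², z)` are `L`-invariant (the coefficients `α, β, γ` of `…AxisKinematics4`).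

WHAT THIS IS NOT: not a claim about Navier–Stokes regularity and not the axis lemma — calculus (bears_on LADDER-NS N0 via item 20428).
-/

noncomputable section

-- the summit and its single sub-problem share the name (CONVENTIONS §1), as in every Theorems file
set_option linter.dupNamespace false

namespace Summit.NavierStokesRegularity.NavierStokesRegularity.Theorems.PoloidalWindowDoorLrcModEntireAxisKinematics6

open Set Function Filter Topology Metric
open scoped RealInnerProductSpace InnerProductSpace
open Literature.Analysis Literature.Analysis.FluidPDE Literature.Analysis.Calculus
open Summit.NavierStokesRegularity.NavierStokesRegularity.Theorems.PoloidalWindowDoorLrcModEntireAxisKinematics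

variable {c₀ c₁ : ℝ → ℝ}

/-! ### The squared distance to a moving vertical axis -/

/-- `g(y) = (y₀ − c₀(y₂))² + (y₁ − c₁(y₂))²` is `Cⁿ` when the centre curve is. -/
theorem contDiff_sqDistMoving {n : WithTop ℕ∞} (hc₀ : ContDiff ℝ n c₀) (hc₁ : ContDiff ℝ n c₁) :
    ContDiff ℝ n (fun y : EuclideanSpace ℝ (Fin 3) => (y 0 - c₀ (y 2)) ^ 2 + (y 1 - c₁ (y 2)) ^ 2) := by
  have h0 : ContDiff ℝ n (fun y : EuclideanSpace ℝ (Fin 3) => y 0) :=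
    (EuclideanSpace.proj (0 : Fin 3) : EuclideanSpace ℝ (Fin 3) →L[ℝ] ℝ).contDiff
  have h1 : ContDiff ℝ n (fun y : EuclideanSpace ℝ (Fin 3) => y 1) :=
    (EuclideanSpace.proj (1 : Fin 3) : EuclideanSpace ℝ (Fin 3) →L[ℝ] ℝ).contDiff
  have h2 : ContDiff ℝ n (fun y : EuclideanSpace ℝ (Fin 3) => y 2) :=
    (EuclideanSpace.proj (2 : Fin 3) : EuclideanSpace ℝ (Fin 3) →L[ℝ] ℝ).contDiff
  exact ((h0.sub (hc₀.comp h2)).pow 2).add ((h1.sub (hc₁.comp h2)).pow 2)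

/-- The derivative of `g`: `Dg(y) v = 2(y₀ − c₀)(v₀ − c₀′ v₂) + 2(y₁ − c₁)(v₁ − c₁′ v₂)`. -/
theorem hasFDerivAt_sqDistMoving {y : EuclideanSpace ℝ (Fin 3)} (hc₀ : DifferentiableAt ℝ c₀ (y 2))
    (hc₁ : DifferentiableAt ℝ c₁ (y 2)) :
    HasFDerivAt (fun y : EuclideanSpace ℝ (Fin 3) => (y 0 - c₀ (y 2)) ^ 2 + (y 1 - c₁ (y 2)) ^ 2)
      ((2 * (y 0 - c₀ (y 2))) • ((EuclideanSpace.proj (0 : Fin 3) : EuclideanSpace ℝ (Fin 3) →L[ℝ] ℝ) -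
          deriv c₀ (y 2) • (EuclideanSpace.proj (2 : Fin 3) : EuclideanSpace ℝ (Fin 3) →L[ℝ] ℝ)) +
        (2 * (y 1 - c₁ (y 2))) • ((EuclideanSpace.proj (1 : Fin 3) : EuclideanSpace ℝ (Fin 3) →L[ℝ] ℝ) -
          deriv c₁ (y 2) • (EuclideanSpace.proj (2 : Fin 3) : EuclideanSpace ℝ (Fin 3) →L[ℝ] ℝ))) y := by
  have h := ((Summit.NavierStokesRegularity.NavierStokesRegularity.Theorems.PoloidalWindowDoorLrcModEntireAxisKinematics3.hasFDerivAt_coordSubFun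
    hc₀ 0).pow 2).add
    ((Summit.NavierStokesRegularity.NavierStokesRegularity.Theorems.PoloidalWindowDoorLrcModEntireAxisKinematics3.hasFDerivAt_coordSubFun
      hc₁ 1).pow 2)
  refine h.congr_fderiv ?_
  ext v
  simp

/-- **Horizontal derivatives of `g`**: `Dg(y) e₀ = 2(y₀ − c₀(y₂))`, `Dg(y) e₁ = 2(y₁ − c₁(y₂))`. -/
theorem fderiv_sqDistMoving_horizontal {y : EuclideanSpace ℝ (Fin 3)} (hc₀ : DifferentiableAt ℝ c₀ (y 2))
    (hc₁ : DifferentiableAt ℝ c₁ (y 2)) :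
    fderiv ℝ (fun y : EuclideanSpace ℝ (Fin 3) => (y 0 - c₀ (y 2)) ^ 2 + (y 1 - c₁ (y 2)) ^ 2) y (EuclideanSpace.single 0 1) =
        2 * (y 0 - c₀ (y 2)) ∧
      fderiv ℝ (fun y : EuclideanSpace ℝ (Fin 3) => (y 0 - c₀ (y 2)) ^ 2 + (y 1 - c₁ (y 2)) ^ 2) y (EuclideanSpace.single 1 1) =
        2 * (y 1 - c₁ (y 2)) := by
  rw [(hasFDerivAt_sqDistMoving hc₀ hc₁).fderiv]
  constructor <;> simp

/-- **The rotational derivative about the moving axis annihilates `g`**: `Dg(y)[J(y − c(y₂))] = 0`, where the centre point is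
`c(y₂) = (c₀(y₂), c₁(y₂), *)` (any third coordinate). -/
theorem fderiv_sqDistMoving_rotGen {y : EuclideanSpace ℝ (Fin 3)} (hc₀ : DifferentiableAt ℝ c₀ (y 2))
    (hc₁ : DifferentiableAt ℝ c₁ (y 2)) (cz : ℝ) :
    fderiv ℝ (fun y : EuclideanSpace ℝ (Fin 3) => (y 0 - c₀ (y 2)) ^ 2 + (y 1 - c₁ (y 2)) ^ 2) y
      (rotGen (y - (WithLp.toLp 2 ![c₀ (y 2), c₁ (y 2), cz] : EuclideanSpace ℝ (Fin 3)))) = 0 := by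
  obtain ⟨h0, h1⟩ := fderiv_sqDistMoving_horizontal hc₀ hc₁
  rw [fderiv_rotGen_sub_eq, h0, h1]
  simp
  ring

/-! ### Rotation germ about a moving axis ⇒ radial structure `P(ρ_c², z)` -/

/-- **Rotation germ (moving centre) ⇒ locally a function of `(ρ_c², x₂)`.**  Let `V : ℝ³ → ℝ` be `Cⁿ` at `y₀` (`n ≠ 0`), the centre curve
`(c₀, c₁)` be `Cⁿ`, and suppose `(y₀ − c₀(y₂))∂₁V(y) − (y₁ − c₁(y₂))∂₀V(y) = 0` for `y` near `y₀`, with `y₀` off the axis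
(`(y₀)₀ ≠ c₀((y₀)₂) ∨ (y₀)₁ ≠ c₁((y₀)₂)`).  Then `V y = P(g y, y₂)` near `y₀` for some `P : ℝ × ℝ → ℝ` of class `Cⁿ` at `(g y₀, (y₀)₂)`,
`g(y) = (y₀ − c₀(y₂))² + (y₁ − c₁(y₂))²`. -/
theorem exists_radial_of_rotGerm_moving {n : WithTop ℕ∞} (hn : n ≠ 0) {V : EuclideanSpace ℝ (Fin 3) → ℝ}
    {y₀ : EuclideanSpace ℝ (Fin 3)} (hV : ContDiffAt ℝ n V y₀) (hc₀ : ContDiff ℝ n c₀) (hc₁ : ContDiff ℝ n c₁)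
    (hrot : ∀ᶠ y in 𝓝 y₀, (y 0 - c₀ (y 2)) * fderiv ℝ V y (EuclideanSpace.single 1 1) -
      (y 1 - c₁ (y 2)) * fderiv ℝ V y (EuclideanSpace.single 0 1) = 0)
    (hoff : y₀ 0 ≠ c₀ (y₀ 2) ∨ y₀ 1 ≠ c₁ (y₀ 2)) :
    ∃ P : ℝ × ℝ → ℝ, ContDiffAt ℝ n P ((y₀ 0 - c₀ (y₀ 2)) ^ 2 + (y₀ 1 - c₁ (y₀ 2)) ^ 2, y₀ 2) ∧
      ∀ᶠ y in 𝓝 y₀, V y = P ((y 0 - c₀ (y 2)) ^ 2 + (y 1 - c₁ (y 2)) ^ 2, y 2) := by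
  set g : EuclideanSpace ℝ (Fin 3) → ℝ := fun y => (y 0 - c₀ (y 2)) ^ 2 + (y 1 - c₁ (y 2)) ^ 2 with hg
  have hgc : ContDiffAt ℝ n g y₀ := (contDiff_sqDistMoving hc₀ hc₁).contDiffAt
  have hc₀d : Differentiable ℝ c₀ := hc₀.differentiable hn
  have hc₁d : Differentiable ℝ c₁ := hc₁.differentiable hn
  -- the bracket `{V, g}_h` vanishes near `y₀`
  have hbr01 : ∀ᶠ y in 𝓝 y₀,
      fderiv ℝ V y (EuclideanSpace.single 0 1) * fderiv ℝ g y (EuclideanSpace.single 1 1) =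
        fderiv ℝ V y (EuclideanSpace.single 1 1) * fderiv ℝ g y (EuclideanSpace.single 0 1) := by
    filter_upwards [hrot] with y hy
    obtain ⟨h0, h1⟩ := fderiv_sqDistMoving_horizontal (hc₀d (y 2)) (hc₁d (y 2))
    rw [h0, h1]
    linarith
  rcases hoff with h0 | h1
  · have hpin : fderiv ℝ g y₀ (EuclideanSpace.single 0 1) ≠ 0 := by
      rw [(fderiv_sqDistMoving_horizontal (hc₀d (y₀ 2)) (hc₁d (y₀ 2))).1]
      exact mul_ne_zero two_ne_zero (sub_ne_zero.2 h0)
    exact exists_comp_slice hn (b₀ := 0) (b₁ := 1) (by decide) (by decide) (by decide) hV hgc hpin hbr01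
  · have hpin : fderiv ℝ g y₀ (EuclideanSpace.single 1 1) ≠ 0 := by
      rw [(fderiv_sqDistMoving_horizontal (hc₀d (y₀ 2)) (hc₁d (y₀ 2))).2]
      exact mul_ne_zero two_ne_zero (sub_ne_zero.2 h1)
    have hbr10 : ∀ᶠ y in 𝓝 y₀,
        fderiv ℝ V y (EuclideanSpace.single 1 1) * fderiv ℝ g y (EuclideanSpace.single 0 1) =
          fderiv ℝ V y (EuclideanSpace.single 0 1) * fderiv ℝ g y (EuclideanSpace.single 1 1) :=
      hbr01.mono fun y hy => hy.symm
    exact exists_comp_slice hn (b₀ := 1) (b₁ := 0) (by decide) (by decide) (by decide) hV hgc hpin hbr10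

/-! ### Functions of `(ρ_c², z)` are `L`-invariant -/

/-- **`L(Q(g, ·₂)) = 0`**: for `Q : ℝ × ℝ → ℝ` differentiable at `(g y, y₂)` and the centre curve differentiable at `y₂`,
`(y₀ − c₀(y₂))·∂₁[Q(g, ·₂)](y) − (y₁ − c₁(y₂))·∂₀[Q(g, ·₂)](y) = 0`. -/
theorem rotDeriv_comp_sqDistMoving {Q : ℝ × ℝ → ℝ} {y : EuclideanSpace ℝ (Fin 3)} (hc₀ : DifferentiableAt ℝ c₀ (y 2))
    (hc₁ : DifferentiableAt ℝ c₁ (y 2))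
    (hQ : DifferentiableAt ℝ Q ((y 0 - c₀ (y 2)) ^ 2 + (y 1 - c₁ (y 2)) ^ 2, y 2)) :
    (y 0 - c₀ (y 2)) * fderiv ℝ (fun y' : EuclideanSpace ℝ (Fin 3) =>
        Q ((y' 0 - c₀ (y' 2)) ^ 2 + (y' 1 - c₁ (y' 2)) ^ 2, y' 2)) y (EuclideanSpace.single 1 1) -
      (y 1 - c₁ (y 2)) * fderiv ℝ (fun y' : EuclideanSpace ℝ (Fin 3) =>
        Q ((y' 0 - c₀ (y' 2)) ^ 2 + (y' 1 - c₁ (y' 2)) ^ 2, y' 2)) y (EuclideanSpace.single 0 1) = 0 := by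
  -- the map `Ψ y = (g y, y₂)` and its derivative
  have hg := hasFDerivAt_sqDistMoving hc₀ hc₁
  have h2 : HasFDerivAt (fun y' : EuclideanSpace ℝ (Fin 3) => y' 2)
      (EuclideanSpace.proj (2 : Fin 3) : EuclideanSpace ℝ (Fin 3) →L[ℝ] ℝ) y :=
    (EuclideanSpace.proj (2 : Fin 3) : EuclideanSpace ℝ (Fin 3) →L[ℝ] ℝ).hasFDerivAt
  have hΨ := hg.prodMk h2
  have hcomp : HasFDerivAt (fun y' : EuclideanSpace ℝ (Fin 3) =>
      Q ((y' 0 - c₀ (y' 2)) ^ 2 + (y' 1 - c₁ (y' 2)) ^ 2, y' 2)) _ y := hQ.hasFDerivAt.comp y hΨ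
  rw [hcomp.fderiv]
  -- derivatives of `Ψ` in the horizontal directions: `(2(y_b − c_b), 0)`
  have hΨ0 : ((2 * (y 0 - c₀ (y 2))) • ((EuclideanSpace.proj (0 : Fin 3) : EuclideanSpace ℝ (Fin 3) →L[ℝ] ℝ) -
          deriv c₀ (y 2) • (EuclideanSpace.proj (2 : Fin 3) : EuclideanSpace ℝ (Fin 3) →L[ℝ] ℝ)) +
        (2 * (y 1 - c₁ (y 2))) • ((EuclideanSpace.proj (1 : Fin 3) : EuclideanSpace ℝ (Fin 3) →L[ℝ] ℝ) -
          deriv c₁ (y 2) • (EuclideanSpace.proj (2 : Fin 3) : EuclideanSpace ℝ (Fin 3) →L[ℝ] ℝ)))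
        (EuclideanSpace.single 0 (1 : ℝ)) = 2 * (y 0 - c₀ (y 2)) := by simp
  have hΨ1 : ((2 * (y 0 - c₀ (y 2))) • ((EuclideanSpace.proj (0 : Fin 3) : EuclideanSpace ℝ (Fin 3) →L[ℝ] ℝ) -
          deriv c₀ (y 2) • (EuclideanSpace.proj (2 : Fin 3) : EuclideanSpace ℝ (Fin 3) →L[ℝ] ℝ)) +
        (2 * (y 1 - c₁ (y 2))) • ((EuclideanSpace.proj (1 : Fin 3) : EuclideanSpace ℝ (Fin 3) →L[ℝ] ℝ) -
          deriv c₁ (y 2) • (EuclideanSpace.proj (2 : Fin 3) : EuclideanSpace ℝ (Fin 3) →L[ℝ] ℝ)))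
        (EuclideanSpace.single 1 (1 : ℝ)) = 2 * (y 1 - c₁ (y 2)) := by simp
  have hp0 : (EuclideanSpace.proj (2 : Fin 3) : EuclideanSpace ℝ (Fin 3) →L[ℝ] ℝ) (EuclideanSpace.single 0 (1 : ℝ)) = 0 := by
    show (EuclideanSpace.single 0 (1 : ℝ) : EuclideanSpace ℝ (Fin 3)) 2 = 0; simp
  have hp1 : (EuclideanSpace.proj (2 : Fin 3) : EuclideanSpace ℝ (Fin 3) →L[ℝ] ℝ) (EuclideanSpace.single 1 (1 : ℝ)) = 0 := by
    show (EuclideanSpace.single 1 (1 : ℝ) : EuclideanSpace ℝ (Fin 3)) 2 = 0; simp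
  simp only [ContinuousLinearMap.comp_apply, ContinuousLinearMap.prod_apply, hΨ0, hΨ1, hp0, hp1]
  -- both values of `DQ` are at vectors proportional to `(1, 0)`: `(2(y_b − c_b), 0) = 2(y_b − c_b) • (1, 0)`
  have e0 : ((2 * (y 0 - c₀ (y 2)) : ℝ), (0 : ℝ)) = (2 * (y 0 - c₀ (y 2))) • ((1 : ℝ), (0 : ℝ)) := by ext <;> simp
  have e1 : ((2 * (y 1 - c₁ (y 2)) : ℝ), (0 : ℝ)) = (2 * (y 1 - c₁ (y 2))) • ((1 : ℝ), (0 : ℝ)) := by ext <;> simp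
  rw [e0, e1, map_smul, map_smul, smul_eq_mul, smul_eq_mul]
  ring

end Summit.NavierStokesRegularity.NavierStokesRegularity.Theorems.PoloidalWindowDoorLrcModEntireAxisKinematics6

end
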